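import Summits.Schanuel.Schanuel.Theorems.ZilberEacBranchAlgebraicLog
import Summits.Schanuel.Schanuel.Theorems.ZilberEacGraphFibreCurveComplete
import HarnessLib

/-!
# Arbitrary base branches, V: THE MASTER THEOREM over an arbitrary base branch — a cylinder germ
# at infinity with `ord x₁ > ord x₀` and a zero or pole branch of the fibre relation give density

HONEST FRAMING.  Cell `pub-schanuel` (Zilber's Exponential-Algebraic Closedness, case ladder;
host summit Schanuel), seat 2, gen 28.  Gen 26 (file LXVI) proved the master theorem over
polynomial graphs, gen 27 (file LXXVIII) over polynomially parametrised curves.  Here the base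
curve is ARBITRARY: only an analytic branch at infinity `(x₀, x₁) = (s^{-k}, Φ(s)s^{-M})`,
`M ≥ k + 1` (the second coordinate grows faster), `Φ(0) ≠ 0`, satisfying an irreducible relation
`A(x₀, x₁) = 0`, enters.
* **`unprojectedDense_branch_cycle_zeroBranch`** — `S ⊆ ℂ² × ℂ²` irreducible closed of dimension
  `≤ 2` containing the cylinder germ `(s^{-k}, Φ(s)s^{-M}, ψ(s), e^{Φ(s)s^{-M}})` (`ψ(0) = θ ≠ 0`,
  `F(s^{-k}, ψ s) = 0`, `F` irreducible of positive `y₀`-degree) and `F` having a parametrised zero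
  branch `x₀ = γ(t)`, `y₀ = η(t) → 0` ⟹ `I(S ∩ Γ_exp) = I(S)`; **`…_poleBranch`** likewise.
  (File IV against gen 25's file XLVIII.)
* **`unprojectedDense_of_baseBranch_fibreCycle_zeroBranch`** — the two local data may come with
  DIFFERENT ramification indices: a base branch `(u^{-k'}, Φ(u)u^{-M'})` (`M' ≥ k' + 1`) of `A = 0`
  and a cycle `(s^{-k}, ψ(s))` of `F = 0` are combined along `u = σ^k`, `s = σ^{k'}`; the surface
  hypothesis is that `S` contains every point `(x₀, x₁, y₀, e^{x₁})` with `A(x₀, x₁) = 0`,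
  `F(x₀, y₀) = 0` (the cylinder over the fibre product of the base curve and the fibre relation).
* **`unprojectedDense_of_baseBranch_fibreCurve`** — with BOTH fibre data supplied by the cell's
  Newton–Puiseux theorem (file LXXII): `F` irreducible of positive `y₀`-degree, top `x₀`-row with a
  nonzero root, lowest `y₀`-row `q₀ ≠ 0` with a root ⟹ dense; **`…_fibreCurve_pole`**: top row
  `q_r` with a root instead.
These are the first density theorems of the cell over base curves that are NOT rational: any
irreducible plane curve with a branch at infinity along which `x₁/x₀ → ∞` polynomially (file VI:
the elliptic curve `x₁² = x₀³ + 1`).  Complete classes of instances of an OPEN question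
(Mantova–Masser, PLMS 2024 §1 p. 5); EC(3,2) OPEN; NOT Schanuel's conjecture (neither used nor
implied); EAC ⇏ SC.
-/

noncomputable section

open Filter Topology Set Complex MvPolynomial
open Literature.NumberTheory.Transcendental Literature.ModelTheory.Zilber
open Literature.ModelTheory.ExponentialFields

set_option linter.dupNamespace false

namespace Summit.Schanuel.Schanuel.Theorems

/-! ## Part A. The master theorems over an arbitrary base branch -/

/-- **Cylinder germ at infinity over an arbitrary base branch + parametrised zero branch ⟹ dense.**
See the module docstring.
[cite: MantovaMasser2023, §1 Further remarks, p. 5 (the question, open in general)] (new) -/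
theorem unprojectedDense_branch_cycle_zeroBranch {S : Set (Fin 2 ⊕ Fin 2 → ℂ)}
    (hS : IsIrreducibleClosed ℂ S) (hdim : zariskiDim ℂ S ≤ (2 : ℕ))
    (F : Polynomial (Polynomial ℂ)) (hFirr : Irreducible F) (hF1 : F.natDegree ≠ 0)
    (A : Polynomial (Polynomial ℂ)) (hAirr : Irreducible A) (hA1 : A.natDegree ≠ 0)
    {k M : ℕ} (hk : 1 ≤ k) (hM : k + 1 ≤ M)
    {ψ : ℂ → ℂ} (hψ : AnalyticAt ℂ ψ 0) {θ : ℂ} (hθ0 : θ ≠ 0) (hψ0 : ψ 0 = θ)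
    {Φ : ℂ → ℂ} (hΦ : AnalyticAt ℂ Φ 0) (hΦ0 : Φ 0 ≠ 0)
    (hbranch : ∀ᶠ s in 𝓝[≠] (0 : ℂ), (F.map (Polynomial.evalRingHom (s ^ k)⁻¹)).eval (ψ s) = 0)
    (hbase : ∀ᶠ s in 𝓝[≠] (0 : ℂ),
      (A.map (Polynomial.evalRingHom (s ^ k)⁻¹)).eval (Φ s * (s ^ M)⁻¹) = 0)
    (hgerm : ∀ᶠ s in 𝓝[≠] (0 : ℂ),
      (Sum.elim ![(s ^ k)⁻¹, Φ s * (s ^ M)⁻¹] ![ψ s, Complex.exp (Φ s * (s ^ M)⁻¹)] :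
        Fin 2 ⊕ Fin 2 → ℂ) ∈ S)
    {γ η : ℂ → ℂ} (hγan : AnalyticAt ℂ γ 0) (hηan : AnalyticAt ℂ η 0) (hη0 : η 0 = 0)
    (hγ' : ∀ᶠ t in 𝓝[≠] (0 : ℂ), deriv γ t ≠ 0) (hηne : ¬ ∀ᶠ t in 𝓝 (0 : ℂ), η t = 0)
    (hFγ : ∀ᶠ t in 𝓝 (0 : ℂ), (F.map (Polynomial.evalRingHom (γ t))).eval (η t) = 0) :
    UnprojectedDense S := by
  by_contra hnot
  obtain ⟨z₀, ρ, L, hLan, hρan, hρ0, hFρ, hL, hLalg⟩ :=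
    exists_algebraic_log_of_not_dense_branch hS hdim F hFirr hF1 A hAirr hA1 hk hM hψ hθ0 hψ0 hΦ hΦ0
      hbranch hbase hgerm hnot
  exact not_isAlgebraic_log_algebraicBranch_param F hFirr hF1 hγan hηan hη0 hγ' hηne hFγ hρan hLan
    hρ0 hFρ hL hLalg

/-- **Cylinder germ at infinity over an arbitrary base branch + parametrised pole branch ⟹ dense**
(`q₀ ≠ 0`, `y₀ = 1/η(t)`).
[cite: MantovaMasser2023, §1 Further remarks, p. 5 (the question, open in general)] (new) -/
theorem unprojectedDense_branch_cycle_poleBranch {S : Set (Fin 2 ⊕ Fin 2 → ℂ)}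
    (hS : IsIrreducibleClosed ℂ S) (hdim : zariskiDim ℂ S ≤ (2 : ℕ))
    (F : Polynomial (Polynomial ℂ)) (hFirr : Irreducible F) (hF1 : F.natDegree ≠ 0)
    (hF00 : F.coeff 0 ≠ 0)
    (A : Polynomial (Polynomial ℂ)) (hAirr : Irreducible A) (hA1 : A.natDegree ≠ 0)
    {k M : ℕ} (hk : 1 ≤ k) (hM : k + 1 ≤ M)
    {ψ : ℂ → ℂ} (hψ : AnalyticAt ℂ ψ 0) {θ : ℂ} (hθ0 : θ ≠ 0) (hψ0 : ψ 0 = θ)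
    {Φ : ℂ → ℂ} (hΦ : AnalyticAt ℂ Φ 0) (hΦ0 : Φ 0 ≠ 0)
    (hbranch : ∀ᶠ s in 𝓝[≠] (0 : ℂ), (F.map (Polynomial.evalRingHom (s ^ k)⁻¹)).eval (ψ s) = 0)
    (hbase : ∀ᶠ s in 𝓝[≠] (0 : ℂ),
      (A.map (Polynomial.evalRingHom (s ^ k)⁻¹)).eval (Φ s * (s ^ M)⁻¹) = 0)
    (hgerm : ∀ᶠ s in 𝓝[≠] (0 : ℂ),
      (Sum.elim ![(s ^ k)⁻¹, Φ s * (s ^ M)⁻¹] ![ψ s, Complex.exp (Φ s * (s ^ M)⁻¹)] :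
        Fin 2 ⊕ Fin 2 → ℂ) ∈ S)
    {γ η : ℂ → ℂ} (hγan : AnalyticAt ℂ γ 0) (hηan : AnalyticAt ℂ η 0) (hη0 : η 0 = 0)
    (hγ' : ∀ᶠ t in 𝓝[≠] (0 : ℂ), deriv γ t ≠ 0) (hηne : ¬ ∀ᶠ t in 𝓝 (0 : ℂ), η t = 0)
    (hFγ : ∀ᶠ t in 𝓝[≠] (0 : ℂ), (F.map (Polynomial.evalRingHom (γ t))).eval (η t)⁻¹ = 0) :
    UnprojectedDense S := by
  by_contra hnot
  obtain ⟨z₀, ρ, L, hLan, hρan, hρ0, hFρ, hL, hLalg⟩ :=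
    exists_algebraic_log_of_not_dense_branch hS hdim F hFirr hF1 A hAirr hA1 hk hM hψ hθ0 hψ0 hΦ hΦ0
      hbranch hbase hgerm hnot
  exact not_isAlgebraic_log_algebraicBranch_param_pole F hFirr hF1 hF00 hγan hηan hη0 hγ' hηne hFγ
    hρan hLan hρ0 hFρ hL hLalg

/-! ## Part B. Two local data with different ramification: the cylinder over a fibre product -/

/-- `σ ↦ σ^n` (`n ≥ 1`) maps the punctured neighbourhood of `0` into itself. [folklore] -/
theorem tendsto_pow_punctured_nhds_zero {n : ℕ} (hn : 1 ≤ n) :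
    Tendsto (fun σ : ℂ => σ ^ n) (𝓝[≠] (0 : ℂ)) (𝓝[≠] 0) := by
  refine tendsto_nhdsWithin_iff.2 ⟨?_, ?_⟩
  · have h := ((continuous_pow n).tendsto (0 : ℂ))
    rw [zero_pow (by omega : n ≠ 0)] at h
    exact h.mono_left nhdsWithin_le_nhds
  · exact eventually_mem_nhdsWithin.mono fun σ hσ => pow_ne_zero n hσ

/-- **Base branch + fibre cycle + zero branch ⟹ dense, for the cylinder over a fibre product.**
`S` irreducible closed of dimension `≤ 2` containing every `(x₀, x₁, y₀, e^{x₁})` with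
`A(x₀, x₁) = 0`, `F(x₀, y₀) = 0`; a branch at infinity `(u^{-k'}, Φ(u)u^{-M'})` of `A = 0` with
`M' ≥ k' + 1`, `Φ(0) ≠ 0`; a cycle at infinity `(s^{-k}, ψ(s))`, `ψ(0) = θ ≠ 0`, and a parametrised
zero branch of `F = 0`.  Then `I(S ∩ Γ_exp) = I(S)`.
[cite: MantovaMasser2023, §1 Further remarks, p. 5 (the question, open in general)] (new) -/
theorem unprojectedDense_of_baseBranch_fibreCycle_zeroBranch {S : Set (Fin 2 ⊕ Fin 2 → ℂ)}
    (hS : IsIrreducibleClosed ℂ S) (hdim : zariskiDim ℂ S ≤ (2 : ℕ))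
    (F : Polynomial (Polynomial ℂ)) (hFirr : Irreducible F) (hF1 : F.natDegree ≠ 0)
    (A : Polynomial (Polynomial ℂ)) (hAirr : Irreducible A) (hA1 : A.natDegree ≠ 0)
    (hsub : ∀ x₀ x₁ y₀ : ℂ, (A.map (Polynomial.evalRingHom x₀)).eval x₁ = 0 →
      (F.map (Polynomial.evalRingHom x₀)).eval y₀ = 0 →
      (Sum.elim ![x₀, x₁] ![y₀, Complex.exp x₁] : Fin 2 ⊕ Fin 2 → ℂ) ∈ S)
    {k' M' : ℕ} (hk' : 1 ≤ k') (hM' : k' + 1 ≤ M')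
    {Φ : ℂ → ℂ} (hΦ : AnalyticAt ℂ Φ 0) (hΦ0 : Φ 0 ≠ 0)
    (hbase : ∀ᶠ u in 𝓝[≠] (0 : ℂ),
      (A.map (Polynomial.evalRingHom (u ^ k')⁻¹)).eval (Φ u * (u ^ M')⁻¹) = 0)
    {k : ℕ} (hk : 1 ≤ k) {ψ : ℂ → ℂ} (hψ : AnalyticAt ℂ ψ 0) {θ : ℂ} (hθ0 : θ ≠ 0) (hψ0 : ψ 0 = θ)
    (hbranch : ∀ᶠ s in 𝓝[≠] (0 : ℂ), (F.map (Polynomial.evalRingHom (s ^ k)⁻¹)).eval (ψ s) = 0)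
    {γ η : ℂ → ℂ} (hγan : AnalyticAt ℂ γ 0) (hηan : AnalyticAt ℂ η 0) (hη0 : η 0 = 0)
    (hγ' : ∀ᶠ t in 𝓝[≠] (0 : ℂ), deriv γ t ≠ 0) (hηne : ¬ ∀ᶠ t in 𝓝 (0 : ℂ), η t = 0)
    (hFγ : ∀ᶠ t in 𝓝 (0 : ℂ), (F.map (Polynomial.evalRingHom (γ t))).eval (η t) = 0) :
    UnprojectedDense S := by
  -- common parameter `σ`: `u = σ^k`, `s = σ^{k'}`, `x₀ = σ^{-kk'}`
  have hk0 : k ≠ 0 := by omega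
  have hk'0 : k' ≠ 0 := by omega
  set K := k * k' with hK
  set Mt := k * M' with hMt
  have hK1 : 1 ≤ K := Nat.one_le_iff_ne_zero.2 (Nat.mul_ne_zero hk0 hk'0)
  have hMK : K + 1 ≤ Mt := by
    rw [hK, hMt]
    have : k * (k' + 1) ≤ k * M' := Nat.mul_le_mul_left k hM'
    rw [Nat.mul_succ] at this
    omega
  set ψt : ℂ → ℂ := fun σ => ψ (σ ^ k') with hψt
  set Φt : ℂ → ℂ := fun σ => Φ (σ ^ k) with hΦt
  have hψtan : AnalyticAt ℂ ψt 0 := by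
    have h1 : AnalyticAt ℂ (fun σ : ℂ => σ ^ k') 0 := analyticAt_id.pow k'
    exact hψ.comp_of_eq h1 (by simp [zero_pow hk'0])
  have hΦtan : AnalyticAt ℂ Φt 0 := by
    have h1 : AnalyticAt ℂ (fun σ : ℂ => σ ^ k) 0 := analyticAt_id.pow k
    exact hΦ.comp_of_eq h1 (by simp [zero_pow hk0])
  have hψt0 : ψt 0 = θ := by simp [hψt, zero_pow hk'0, hψ0]
  have hΦt0 : Φt 0 ≠ 0 := by simp [hΦt, zero_pow hk0]; exact hΦ0
  have hpowk : ∀ σ : ℂ, ((σ ^ k') ^ k)⁻¹ = (σ ^ K)⁻¹ := fun σ => by rw [hK, ← pow_mul, mul_comm]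
  have hpowk' : ∀ σ : ℂ, ((σ ^ k) ^ k')⁻¹ = (σ ^ K)⁻¹ := fun σ => by rw [hK, ← pow_mul]
  have hpowM : ∀ σ : ℂ, ((σ ^ k) ^ M')⁻¹ = (σ ^ Mt)⁻¹ := fun σ => by rw [hMt, ← pow_mul]
  have hbranch' : ∀ᶠ σ in 𝓝[≠] (0 : ℂ),
      (F.map (Polynomial.evalRingHom (σ ^ K)⁻¹)).eval (ψt σ) = 0 := by
    filter_upwards [(tendsto_pow_punctured_nhds_zero hk').eventually hbranch] with σ hσ
    rw [← hpowk σ]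
    exact hσ
  have hbase' : ∀ᶠ σ in 𝓝[≠] (0 : ℂ),
      (A.map (Polynomial.evalRingHom (σ ^ K)⁻¹)).eval (Φt σ * (σ ^ Mt)⁻¹) = 0 := by
    filter_upwards [(tendsto_pow_punctured_nhds_zero hk).eventually hbase] with σ hσ
    rw [← hpowk' σ, ← hpowM σ]
    exact hσ
  have hgerm : ∀ᶠ σ in 𝓝[≠] (0 : ℂ),
      (Sum.elim ![(σ ^ K)⁻¹, Φt σ * (σ ^ Mt)⁻¹] ![ψt σ, Complex.exp (Φt σ * (σ ^ Mt)⁻¹)] :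
        Fin 2 ⊕ Fin 2 → ℂ) ∈ S := by
    filter_upwards [hbranch', hbase'] with σ hb hA
    exact hsub _ _ _ hA hb
  exact unprojectedDense_branch_cycle_zeroBranch hS hdim F hFirr hF1 A hAirr hA1 hK1 hMK hψtan hθ0
    hψt0 hΦtan hΦt0 hbranch' hbase' hgerm hγan hηan hη0 hγ' hηne hFγ

/-- **The same with a parametrised POLE branch of `F = 0`** (`q₀ ≠ 0`).
[cite: MantovaMasser2023, §1 Further remarks, p. 5 (the question, open in general)] (new) -/
theorem unprojectedDense_of_baseBranch_fibreCycle_poleBranch {S : Set (Fin 2 ⊕ Fin 2 → ℂ)}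
    (hS : IsIrreducibleClosed ℂ S) (hdim : zariskiDim ℂ S ≤ (2 : ℕ))
    (F : Polynomial (Polynomial ℂ)) (hFirr : Irreducible F) (hF1 : F.natDegree ≠ 0)
    (hF00 : F.coeff 0 ≠ 0)
    (A : Polynomial (Polynomial ℂ)) (hAirr : Irreducible A) (hA1 : A.natDegree ≠ 0)
    (hsub : ∀ x₀ x₁ y₀ : ℂ, (A.map (Polynomial.evalRingHom x₀)).eval x₁ = 0 →
      (F.map (Polynomial.evalRingHom x₀)).eval y₀ = 0 →
      (Sum.elim ![x₀, x₁] ![y₀, Complex.exp x₁] : Fin 2 ⊕ Fin 2 → ℂ) ∈ S)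
    {k' M' : ℕ} (hk' : 1 ≤ k') (hM' : k' + 1 ≤ M')
    {Φ : ℂ → ℂ} (hΦ : AnalyticAt ℂ Φ 0) (hΦ0 : Φ 0 ≠ 0)
    (hbase : ∀ᶠ u in 𝓝[≠] (0 : ℂ),
      (A.map (Polynomial.evalRingHom (u ^ k')⁻¹)).eval (Φ u * (u ^ M')⁻¹) = 0)
    {k : ℕ} (hk : 1 ≤ k) {ψ : ℂ → ℂ} (hψ : AnalyticAt ℂ ψ 0) {θ : ℂ} (hθ0 : θ ≠ 0) (hψ0 : ψ 0 = θ)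
    (hbranch : ∀ᶠ s in 𝓝[≠] (0 : ℂ), (F.map (Polynomial.evalRingHom (s ^ k)⁻¹)).eval (ψ s) = 0)
    {γ η : ℂ → ℂ} (hγan : AnalyticAt ℂ γ 0) (hηan : AnalyticAt ℂ η 0) (hη0 : η 0 = 0)
    (hγ' : ∀ᶠ t in 𝓝[≠] (0 : ℂ), deriv γ t ≠ 0) (hηne : ¬ ∀ᶠ t in 𝓝 (0 : ℂ), η t = 0)
    (hFγ : ∀ᶠ t in 𝓝[≠] (0 : ℂ), (F.map (Polynomial.evalRingHom (γ t))).eval (η t)⁻¹ = 0) :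
    UnprojectedDense S := by
  have hk0 : k ≠ 0 := by omega
  have hk'0 : k' ≠ 0 := by omega
  set K := k * k' with hK
  set Mt := k * M' with hMt
  have hK1 : 1 ≤ K := Nat.one_le_iff_ne_zero.2 (Nat.mul_ne_zero hk0 hk'0)
  have hMK : K + 1 ≤ Mt := by
    rw [hK, hMt]
    have : k * (k' + 1) ≤ k * M' := Nat.mul_le_mul_left k hM'
    rw [Nat.mul_succ] at this
    omega
  set ψt : ℂ → ℂ := fun σ => ψ (σ ^ k') with hψt
  set Φt : ℂ → ℂ := fun σ => Φ (σ ^ k) with hΦt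
  have hψtan : AnalyticAt ℂ ψt 0 := by
    have h1 : AnalyticAt ℂ (fun σ : ℂ => σ ^ k') 0 := analyticAt_id.pow k'
    exact hψ.comp_of_eq h1 (by simp [zero_pow hk'0])
  have hΦtan : AnalyticAt ℂ Φt 0 := by
    have h1 : AnalyticAt ℂ (fun σ : ℂ => σ ^ k) 0 := analyticAt_id.pow k
    exact hΦ.comp_of_eq h1 (by simp [zero_pow hk0])
  have hψt0 : ψt 0 = θ := by simp [hψt, zero_pow hk'0, hψ0]
  have hΦt0 : Φt 0 ≠ 0 := by simp [hΦt, zero_pow hk0]; exact hΦ0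
  have hpowk : ∀ σ : ℂ, ((σ ^ k') ^ k)⁻¹ = (σ ^ K)⁻¹ := fun σ => by rw [hK, ← pow_mul, mul_comm]
  have hpowk' : ∀ σ : ℂ, ((σ ^ k) ^ k')⁻¹ = (σ ^ K)⁻¹ := fun σ => by rw [hK, ← pow_mul]
  have hpowM : ∀ σ : ℂ, ((σ ^ k) ^ M')⁻¹ = (σ ^ Mt)⁻¹ := fun σ => by rw [hMt, ← pow_mul]
  have hbranch' : ∀ᶠ σ in 𝓝[≠] (0 : ℂ),
      (F.map (Polynomial.evalRingHom (σ ^ K)⁻¹)).eval (ψt σ) = 0 := by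
    filter_upwards [(tendsto_pow_punctured_nhds_zero hk').eventually hbranch] with σ hσ
    rw [← hpowk σ]
    exact hσ
  have hbase' : ∀ᶠ σ in 𝓝[≠] (0 : ℂ),
      (A.map (Polynomial.evalRingHom (σ ^ K)⁻¹)).eval (Φt σ * (σ ^ Mt)⁻¹) = 0 := by
    filter_upwards [(tendsto_pow_punctured_nhds_zero hk).eventually hbase] with σ hσ
    rw [← hpowk' σ, ← hpowM σ]
    exact hσ
  have hgerm : ∀ᶠ σ in 𝓝[≠] (0 : ℂ),
      (Sum.elim ![(σ ^ K)⁻¹, Φt σ * (σ ^ Mt)⁻¹] ![ψt σ, Complex.exp (Φt σ * (σ ^ Mt)⁻¹)] :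
        Fin 2 ⊕ Fin 2 → ℂ) ∈ S := by
    filter_upwards [hbranch', hbase'] with σ hb hA
    exact hsub _ _ _ hA hb
  exact unprojectedDense_branch_cycle_poleBranch hS hdim F hFirr hF1 hF00 A hAirr hA1 hK1 hMK hψtan
    hθ0 hψt0 hΦtan hΦt0 hbranch' hbase' hgerm hγan hηan hη0 hγ' hηne hFγ

/-! ## Part C. Both fibre data from Newton–Puiseux: every fibre curve with a nonzero top-row root -/

/-- **Every fibre relation with a nonzero top-row root and a root of `q₀` gives a dense cylinder
over an arbitrary base branch with `ord x₁ > ord x₀`.**  `F ∈ ℂ[x₀][y₀]` irreducible of positive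
`y₀`-degree, rows of degree `≤ N` in `x₀`, top row `T ≠ 0` with a root `θ ≠ 0`, lowest row
`q₀ ≠ 0` with a root `a` (Newton–Puiseux, file LXXII, supplies the cycle at infinity and the zero
branch); the base branch and the surface as in Part B.
[cite: MantovaMasser2023, §1 Further remarks, p. 5 (the question, open in general)] (new) -/
theorem unprojectedDense_of_baseBranch_fibreCurve {S : Set (Fin 2 ⊕ Fin 2 → ℂ)}
    (hS : IsIrreducibleClosed ℂ S) (hdim : zariskiDim ℂ S ≤ (2 : ℕ))
    (F : Polynomial (Polynomial ℂ)) (hFirr : Irreducible F) (hF1 : F.natDegree ≠ 0)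
    (N : ℕ) (hN : ∀ j, (F.coeff j).natDegree ≤ N)
    (T : Polynomial ℂ) (hT : ∀ j, T.coeff j = (F.coeff j).coeff N) (hT0 : T ≠ 0) {θ : ℂ}
    (hθ0 : θ ≠ 0) (hTθ : T.IsRoot θ) (hF00 : F.coeff 0 ≠ 0) {a : ℂ} (ha : (F.coeff 0).IsRoot a)
    (A : Polynomial (Polynomial ℂ)) (hAirr : Irreducible A) (hA1 : A.natDegree ≠ 0)
    (hsub : ∀ x₀ x₁ y₀ : ℂ, (A.map (Polynomial.evalRingHom x₀)).eval x₁ = 0 →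
      (F.map (Polynomial.evalRingHom x₀)).eval y₀ = 0 →
      (Sum.elim ![x₀, x₁] ![y₀, Complex.exp x₁] : Fin 2 ⊕ Fin 2 → ℂ) ∈ S)
    {k' M' : ℕ} (hk' : 1 ≤ k') (hM' : k' + 1 ≤ M')
    {Φ : ℂ → ℂ} (hΦ : AnalyticAt ℂ Φ 0) (hΦ0 : Φ 0 ≠ 0)
    (hbase : ∀ᶠ u in 𝓝[≠] (0 : ℂ),
      (A.map (Polynomial.evalRingHom (u ^ k')⁻¹)).eval (Φ u * (u ^ M')⁻¹) = 0) :
    UnprojectedDense S := by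
  obtain ⟨k, ψ, hk, hψ, hψ0, hbranch⟩ := exists_fibreCycle_puiseux F hFirr hF1 N hN T hT hT0 hTθ
  obtain ⟨e, η, he, hηan, hη0, hηne, hFη⟩ := exists_zeroBranch_puiseux F hFirr hF1 hF00 ha
  exact unprojectedDense_of_baseBranch_fibreCycle_zeroBranch hS hdim F hFirr hF1 A hAirr hA1 hsub hk' hM'
    hΦ hΦ0 hbase hk hψ hθ0 hψ0 hbranch (analyticAt_const.add (analyticAt_id.pow e)) hηan hη0
    (deriv_newtonBase_ne_zero a he) hηne hFη

end Summit.Schanuel.Schanuel.Theorems
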